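import Literature.Geometry.MetricGeometry.GeodesicLines
import Literature.Geometry.MetricGeometry.PointedGromovHausdorff
import HarnessLib

/-!
# Lines pass to pointed Gromov–Hausdorff limits

The Euclidean factor of the limit space in Huang–Huang–Wang–Zhu 2026, §4, p. 13 — the pointed
equivariant Gromov–Hausdorff limit `(M̂ᵢ, p̂ᵢ, Hᵢ) → (ℝˢ × Ŷ, (0ˢ, ŷ_∞), H)` of the covers of
diagram (4.1), "where `Ŷ` cannot split off an `ℝ`-factor … by the Cheeger–Gromoll's trick" — is
produced by the splitting theorem from LINES of the limit space, and the lines of the limit are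
limits of lines of the `M̂ᵢ` passing uniformly close to the base points (each cover `M̂ᵢ` of a
compact manifold with infinite deck group contains a line within `diam Mᵢ` of any point:
`Literature/Geometry/Riemannian/CyclicCoverLine.lean` for the `b = 1` covers, from
`GeodesicLines.lean`). This file proves the passage to the limit, in the tree's vocabulary of
pointed Gromov–Hausdorff convergence (`PointedGHConv`, `IsPointedGHApprox` of
`PointedGromovHausdorff.lean`), with the same subconvergence argument as Petersen 2006, Ch. 9,
§3.2 (proof of Lemma 41: "`d(σ(s), σ(t)) = lim d(σᵢ(s), σᵢ(t)) = |s - t|`"):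

* `exists_isometry_real_of_tendsto_dist` — **asymptotically isometric, pointwise confined maps
  `βₙ : ℚ → Y` into a proper metric space subconverge to a line**: if `βₙ q` stays in a compact set
  depending only on `q` and `dist (βₙ q) (βₙ q') → |q - q'|` for all rationals `q, q'`, there are an
  isometric embedding `σ : ℝ → Y` and a subsequence along which `βₙ q → σ q` for every rational `q`;
* `PointedGHConv.exists_isometry_real` — **if `(Xᵢ, pᵢ) → (Y, q)` in the pointed Gromov–Hausdorff
  sense, `Y` is proper, and every `Xᵢ` contains a line `σᵢ` with `dist (σᵢ 0) pᵢ ≤ D`, then `Y`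
  contains a line `σ` with `dist (σ 0) q ≤ D`.**

Everything is proved; no definitions, no named facts.

## References

* P. Petersen, *Riemannian Geometry*, 2nd ed., GTM 171 (2006), Ch. 9, §3.2, Lemma 41 (proof).
  [Petersen2006]
* H. Huang, X.-T. Huang, J. Wang, X. Zhu, arXiv:2605.24380 (2026), §2.1 p. 6 (pointed
  Gromov–Hausdorff approximations), §4 p. 13 (diagram (4.1), the Cheeger–Gromoll trick).
  [HuangHuangWangZhu2026]
* J. Cheeger, D. Gromoll, J. Differential Geom. 6 (1971) 119–128. [CheegerGromoll1971]
-/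

noncomputable section

open Set Filter Metric Topology Bornology

namespace Literature.Geometry.MetricGeometry

/-! ### §1. Asymptotically isometric confined maps subconverge to a line -/

section Limit

variable {Y : Type*} [MetricSpace Y] [ProperSpace Y]

/-- **Subconvergence to a line, asymptotic form** (Petersen 2006, Ch. 9, §3.2, proof of Lemma 41:
"`σᵢ` converges pointwise to `σ` … and thus `d(σ(s), σ(t)) = lim d(σᵢ(s), σᵢ(t)) = |s - t|`"): let
`βₙ : ℚ → Y` be maps into a proper metric space with `βₙ q ∈ C q`, `C q` compact, and
`dist (βₙ q) (βₙ q') → |q - q'|` as `n → ∞` for all rationals `q, q'`. Then there are an isometric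
embedding `σ : ℝ → Y` and a subsequence `φ` with `β_{φ n} q → σ q` for every rational `q`
(extraction in the compact product `∏ C q`, the limit is isometric on `ℚ` and extends to `ℝ` by
completeness and density). [cite: Petersen2006, Ch. 9 §3.2 Lemma 41 (proof)] -/
theorem exists_isometry_real_of_tendsto_dist {β : ℕ → ℚ → Y} {C : ℚ → Set Y}
    (hC : ∀ q, IsCompact (C q)) (hmem : ∀ n q, β n q ∈ C q)
    (hdist : ∀ q q' : ℚ, Tendsto (fun n ↦ dist (β n q) (β n q')) atTop (𝓝 |(q : ℝ) - q'|)) :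
    ∃ (σ : ℝ → Y) (φ : ℕ → ℕ), Isometry σ ∧ StrictMono φ ∧
      ∀ q : ℚ, Tendsto (fun n ↦ β (φ n) q) atTop (𝓝 (σ q)) := by
  have hCc : IsCompact (Set.pi univ C) := isCompact_univ_pi hC
  have hF : ∀ n, β n ∈ Set.pi univ C := fun n q _ ↦ hmem n q
  obtain ⟨L, -, φ, hφ, hlim⟩ := hCc.tendsto_subseq hF
  have hLq : ∀ q : ℚ, Tendsto (fun n ↦ β (φ n) q) atTop (𝓝 (L q)) := fun q ↦
    tendsto_pi_nhds.1 hlim q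
  -- the limit is isometric on `ℚ`
  have hLiso : ∀ q q' : ℚ, dist (L q) (L q') = |(q : ℝ) - q'| := fun q q' ↦
    tendsto_nhds_unique ((hLq q).dist (hLq q')) ((hdist q q').comp hφ.tendsto_atTop)
  -- extension of `L` to `ℝ`
  have hLu : UniformContinuous L :=
    (LipschitzWith.mk_one (f := L) fun q q' ↦ by rw [hLiso, Rat.dist_eq]).uniformContinuous
  have he : IsUniformInducing ((↑) : ℚ → ℝ) := Rat.isUniformEmbedding_coe_real.isUniformInducing
  have hde : DenseRange ((↑) : ℚ → ℝ) := Rat.denseRange_cast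
  set ψ : ℝ → Y := (he.isDenseInducing hde).extend L with hψ
  have hψq : ∀ q : ℚ, ψ q = L q := uniformly_extend_of_ind he hde hLu
  have hψc : Continuous ψ := (uniformContinuous_uniformly_extend he hde hLu).continuous
  have hψiso : ∀ a b : ℝ, dist (ψ a) (ψ b) = |a - b| := fun a b ↦ by
    refine hde.induction_on₂ (p := fun a b ↦ dist (ψ a) (ψ b) = |a - b|) ?_ ?_ a b
    · exact isClosed_eq (continuous_dist.comp (hψc.prodMap hψc))
        (continuous_abs.comp (continuous_fst.sub continuous_snd))
    · intro q q'
      rw [hψq, hψq, hLiso]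
  refine ⟨ψ, φ, Isometry.of_dist_eq fun a b ↦ by rw [hψiso, Real.dist_eq], hφ, fun q ↦ ?_⟩
  rw [hψq]
  exact hLq q

end Limit

/-! ### §2. Lines in pointed Gromov–Hausdorff limits -/

section GH

variable {X : ℕ → Type*} [∀ i, PseudoMetricSpace (X i)] {Y : Type*} [MetricSpace Y] [ProperSpace Y]
  {p : ∀ i, X i} {q : Y}

/-- **Lines pass to pointed Gromov–Hausdorff limits** (the "Cheeger–Gromoll trick" input of
Huang–Huang–Wang–Zhu 2026, §4 p. 13, for the limit `(M̂ᵢ, p̂ᵢ) → ℝˢ × Ŷ`; Petersen 2006, Ch. 9,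
§3.2, proof of Lemma 41 for the limiting argument): if `(Xᵢ, pᵢ) → (Y, q)` in the pointed
Gromov–Hausdorff sense (`PointedGHConv`), `Y` is a proper metric space, and every `Xᵢ` contains an
isometrically embedded line `σᵢ : ℝ → Xᵢ` with `dist (σᵢ 0) pᵢ ≤ D`, then `Y` contains an
isometrically embedded line `σ : ℝ → Y` with `dist (σ 0) q ≤ D`. Proof: transport `σᵢ|_{[-n,n] ∩ ℚ}`
by pointed `(D + n, 1/(n+1))`-approximations `Xᵢ → Y` (`i = i(n)` large), obtaining maps
`βₙ : ℚ → Y` confined in `B̄(q, D + |t| + 1)` with `dist (βₙ s) (βₙ t) → |s - t|`, and apply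
`exists_isometry_real_of_tendsto_dist`. [cite: HuangHuangWangZhu2026, §4 p. 13; Petersen2006, Ch. 9 §3.2 Lemma 41 (proof)] -/
theorem PointedGHConv.exists_isometry_real (h : PointedGHConv p q) {D : ℝ}
    (hline : ∀ i, ∃ σ : ℝ → X i, Isometry σ ∧ dist (σ 0) (p i) ≤ D) :
    ∃ σ : ℝ → Y, Isometry σ ∧ dist (σ 0) q ≤ D := by
  have hD : 0 ≤ D := by
    obtain ⟨σ, -, h0⟩ := hline 0
    exact dist_nonneg.trans h0
  choose σ hσ hσ0 using hline
  -- for each `n`, an index `i n` and a pointed `(D + n, ε n)`-approximation `f n : X (i n) → Y`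
  set ε : ℕ → ℝ := fun n ↦ 1 / ((n : ℝ) + 1) with hε
  have hεpos : ∀ n, 0 < ε n := fun n ↦ by positivity
  have hex : ∀ n : ℕ, ∃ (i : ℕ) (f : X i → Y), IsPointedGHApprox (D + n) (ε n) (p i) q f :=
    fun n ↦ by
      obtain ⟨i, hi⟩ := (h (D + n) (ε n) (hεpos n)).exists
      exact ⟨i, hi⟩
  choose i f hf using hex
  -- the transported maps on the rationals, frozen at `q` outside `[-n, n]`
  classical
  set β : ℕ → ℚ → Y := fun n t ↦ if |(t : ℝ)| ≤ n then f n (σ (i n) t) else q with hβ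
  -- points of the line within `n` of `σ 0` lie in the ball of the approximation
  have hball : ∀ (n : ℕ) (t : ℚ), |(t : ℝ)| ≤ n → σ (i n) t ∈ closedBall (p (i n)) (D + n) := by
    intro n t ht
    rw [mem_closedBall]
    calc dist (σ (i n) t) (p (i n)) ≤ dist (σ (i n) t) (σ (i n) 0) + dist (σ (i n) 0) (p (i n)) :=
          dist_triangle _ _ _
      _ = |(t : ℝ)| + dist (σ (i n) 0) (p (i n)) := by
          rw [(hσ (i n)).dist_eq, Real.dist_eq, sub_zero]
      _ ≤ D + n := by linarith [hσ0 (i n)]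
  have hp0 : ∀ n : ℕ, p (i n) ∈ closedBall (p (i n)) (D + n) := fun n ↦
    mem_closedBall_self (by positivity)
  -- confinement: `β n t ∈ B̄(q, D + |t| + 1)`
  have hmem : ∀ (n : ℕ) (t : ℚ), β n t ∈ closedBall q (D + |(t : ℝ)| + 1) := by
    intro n t
    simp only [hβ]
    split_ifs with ht
    · rw [mem_closedBall, ← (hf n).map_pt]
      have h1 := (hf n).dist_le (hball n t ht) (hp0 n)
      have h2 : dist (σ (i n) t) (p (i n)) ≤ |(t : ℝ)| + D := by
        calc dist (σ (i n) t) (p (i n))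
            ≤ dist (σ (i n) t) (σ (i n) 0) + dist (σ (i n) 0) (p (i n)) := dist_triangle _ _ _
          _ = |(t : ℝ)| + dist (σ (i n) 0) (p (i n)) := by
              rw [(hσ (i n)).dist_eq, Real.dist_eq, sub_zero]
          _ ≤ |(t : ℝ)| + D := by linarith [hσ0 (i n)]
      have h3 : ε n ≤ 1 := by
        simp only [hε]
        rw [div_le_one (by positivity)]
        linarith [Nat.cast_nonneg (α := ℝ) n]
      linarith
    · exact mem_closedBall_self (by positivity)
  -- asymptotic isometry: `dist (β n s) (β n t) → |s - t|`
  have hdist : ∀ s t : ℚ, Tendsto (fun n ↦ dist (β n s) (β n t)) atTop (𝓝 |(s : ℝ) - t|) := by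
    intro s t
    have hεlim : Tendsto ε atTop (𝓝 0) := by
      simp only [hε]
      exact tendsto_one_div_add_atTop_nhds_zero_nat
    have hev : ∀ᶠ n : ℕ in atTop, |dist (β n s) (β n t) - (|(s : ℝ) - t|)| ≤ ε n := by
      refine (eventually_ge_atTop (⌈|(s : ℝ)|⌉₊ + ⌈|(t : ℝ)|⌉₊)).mono fun n hn ↦ ?_
      have hn' : (⌈|(s : ℝ)|⌉₊ : ℝ) + ⌈|(t : ℝ)|⌉₊ ≤ n := by exact_mod_cast hn
      have hs : |(s : ℝ)| ≤ n :=
        (Nat.le_ceil _).trans (by linarith [Nat.cast_nonneg (α := ℝ) ⌈|(t : ℝ)|⌉₊])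
      have ht : |(t : ℝ)| ≤ n :=
        (Nat.le_ceil _).trans (by linarith [Nat.cast_nonneg (α := ℝ) ⌈|(s : ℝ)|⌉₊])
      have hβs : β n s = f n (σ (i n) s) := by simp only [hβ, if_pos hs]
      have hβt : β n t = f n (σ (i n) t) := by simp only [hβ, if_pos ht]
      rw [hβs, hβt]
      have key := (hf n).abs_sub_le (hball n s hs) (hball n t ht)
      rwa [(hσ (i n)).dist_eq, Real.dist_eq] at key
    refine tendsto_const_nhds.congr_dist (squeeze_zero_norm' ?_ hεlim)
    exact hev.mono fun n hn ↦ by rwa [Real.norm_eq_abs, dist_comm, Real.dist_eq, abs_abs]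
  obtain ⟨τ, φ, hτ, hφ, hlim⟩ := exists_isometry_real_of_tendsto_dist
    (fun t ↦ isCompact_closedBall q (D + |(t : ℝ)| + 1)) hmem hdist
  refine ⟨τ, hτ, ?_⟩
  -- the base point: `dist (β n 0) q ≤ D + ε n`, pass to the limit
  have h0 : Tendsto (fun n ↦ β (φ n) 0) atTop (𝓝 (τ 0)) := by
    simpa only [Rat.cast_zero] using hlim 0
  have hle : ∀ n, dist (β n 0) q ≤ D + ε n := fun n ↦ by
    have : β n 0 = f n (σ (i n) 0) := by
      simp only [hβ, Rat.cast_zero, abs_zero]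
      rw [if_pos (Nat.cast_nonneg n)]
    rw [this, ← (hf n).map_pt]
    have hb0 : σ (i n) 0 ∈ closedBall (p (i n)) (D + n) :=
      mem_closedBall.2 ((hσ0 (i n)).trans (by linarith [Nat.cast_nonneg (α := ℝ) n]))
    have h1 := (hf n).dist_le hb0 (hp0 n)
    linarith [hσ0 (i n)]
  have hεφ : Tendsto (fun n ↦ D + ε (φ n)) atTop (𝓝 (D + 0)) :=
    tendsto_const_nhds.add (tendsto_one_div_add_atTop_nhds_zero_nat.comp hφ.tendsto_atTop)
  rw [add_zero] at hεφ
  exact le_of_tendsto_of_tendsto' (h0.dist tendsto_const_nhds) hεφ fun n ↦ hle (φ n)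

end GH

end Literature.Geometry.MetricGeometry
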